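import Summits.Ventures.LatticeQCDFlow.TrivializingMaps.GibbsVarianceFloor
import Summits.Ventures.LatticeQCDFlow.TrivializingMaps.WilsonLinkFibre
import Summits.Ventures.LatticeQCDFlow.TrivializingMaps.WilsonNonInteractingLinks
import Summits.Ventures.LatticeQCDFlow.TrivializingMaps.AnnealingAnyGroup

/-!
HONEST FRAMING: exact (Metropolis-corrected) sampling algorithms for lattice gauge theory; figures
of merit are autocorrelation/cost numbers at stated couplings and volumes; no continuum-physics
claim.

# WilsonVarianceFloorAllCouplings — THE VARIANCE OF THE WILSON ACTION IS EXTENSIVE AT **EVERY**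
# COUPLING, UNIFORMLY IN THE VOLUME: `Var_{μ_β}(S_W) ≥ e^{-c_{d,N}|β|} · ⌊L/2⌋^d · Var_Haar(Re tr ρ)` FOR
# EVERY COMPACT GAUGE GROUP; HENCE A FISHER ZERO WITHIN `O(e^{c|β|})` OF EVERY REAL COUPLING IN EVERY
# VOLUME, AND THE ANNEALING COST LAW AT ALL COUPLINGS (lean-2 GEN-9, ours)

Venture-side (OURS).  Cell `lqcd-flow` (pub-lqcd), unit `pub-lqcd-lean-2-g9`, 2026-08-22.  GEN-8 proved
the volume-uniform specific-heat floor only inside the (astronomically small) Kotecký–Preiss window,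
noting that beyond it "no sign control of Wilson loops" was available.  None is needed: the law of
total variance along the Haar fibres of a set of NON-INTERACTING links (`GibbsFibreVariance`,
`GibbsVarianceFloor`) and the finite-energy comparison of a local observable with its `β = 0` law give,
for `G` compact second countable, `ρ` continuous unitary, `d ≥ 2`, EVERY `L ≥ 2` and EVERY real `β`,
with `K = (d+1)d²` and `c = 2NK(1 + 4K)`:

* **`wilson_variance_ge_allCouplings`** —
  `Var_{μ_β}(S_W^ρ) ≥ e^{-c|β|} · ⌊L/2⌋^d · Var_Haar(Re tr ρ)`
  (`μ_β = wilsonMeasure ρ β`; the links `(2x, 0)` of the even sublattice, `WilsonNonInteractingLinks`;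
  the `β = 0` input `E_D[fibre variance of S_e] = #plaqThrough(e)·Var_Haar(Re tr ρ) ≥ Var_Haar(Re tr ρ)`,
  `WilsonLinkFibre`).
* **`wilson_exists_fisherZero_near_allCouplings`** — if `Var_Haar(Re tr ρ) > 0`: for every real `β` the
  partition function `Z_L(s) = ∫ D[U] e^{-sS_W}` has a zero `s₀` with
  `|s₀ − β| ≤ 4N d² 3^d e^{c|β|} / Var_Haar(Re tr ρ)` — a radius INDEPENDENT OF THE VOLUME (GEN-7's
  radius law `dist(β, zeros) ≤ 4·half-range/Var_β` with the floor); Fisher zeros accumulate within `O(1)`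
  of every real coupling, not only of `β = 0`.
* **`wilson_weight_sq_ge_exp_allCouplings`** — one exact reweighting step `β → β + δ` (`δ ≥ 0`) has
  importance-weight second moment `E_{μ_β}[w²] ≥ exp(δ² · e^{-c·max(|β|,|β+2δ|)} · ⌊L/2⌋^d · Var_Haar(Re tr ρ))`;
  **`wilson_schedule_cost_ge_allCouplings`** — a `k`-step schedule inside `[−M, M]` costs
  `≥ e^{-cM} · ⌊L/2⌋^d · Var_Haar(Re tr ρ) · (β_k − β_0)²/k`: at EVERY coupling the number of reweighting /
  annealing steps at fixed per-step weight variance must grow linearly with the volume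
  (`ReweightingStepLawAnyGroup`, `AnnealingAnyGroup`; GEN-8 had this inside the KP window only).

PARALLEL WORK (recorded honestly): theory2's HOME-tier item 126 (`Theory2.ExtensiveSpecificHeat`, GEN-39,
2026-08-22T20:00Z, two hours before this file; custody landing by this seat per LEAD LINE 245) proves the
same floor by the same Dobrushin–Tirozzi mechanism with the SHARPER rate `exp(−8N(d−1)|β|)` and count
`L·⌊L/2⌋^{d−1}` (staple decoupling instead of this chain's crude block count); the corollaries of §2–§3
below hold verbatim with any such floor.  This chain's own contribution is the abstract one-link engine
(`GibbsFibreVariance`, any action split `S = f_e + r_e`) and the typed corollaries.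

NOT CLAIMED: the true rate (`c` is a crude count: `#plaqThrough(e) ≤ (d+1)d²` instead of `2(d−1)`, the
block of `S_e` bounded by `4(d+1)d²` links instead of `6d−5`; item 126 has `8N(d−1)`); `L = 1`;
`β`-dependence beyond `e^{-c|β|}` (the truth at weak coupling is polynomial); cost / autocorrelation /
continuum statements.
Literature grade (cell rule): known mechanism (non-degeneracy of the variance of a sum of local
observables by conditioning on a sublattice, Dobrushin–Tirozzi 1977; finite energy); new typing — a
volume-uniform specific-heat floor and Fisher zeros near every real coupling for every compact gauge
group appear not to be stated in print in this form (presearch: corpus + galaxy, none).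
-/

noncomputable section

open MeasureTheory ProbabilityTheory Filter Topology Set
open Literature.MathematicalPhysics.QuantumFieldTheory
open Literature.MathematicalPhysics.QuantumFieldTheory.Luscher2010

namespace Summit.Ventures.LatticeQCDFlow.TrivializingMaps

variable {d L N : ℕ} [NeZero L] {G : Type*} [Group G] [TopologicalSpace G] [IsTopologicalGroup G]
  [CompactSpace G] [MeasurableSpace G] [BorelSpace G] [SecondCountableTopology G]
  (ρ : G →* Matrix (Fin N) (Fin N) ℂ)

/-! ## §1 The extensive variance floor at every coupling -/

/-- The Wilson measure as a tilt of `D[U]` by `-(β S_W)`. [folklore] -/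
theorem wilsonMeasure_eq_tilted_neg_mul (hρ : Continuous ρ) (β : ℝ) :
    wilsonMeasure (d := d) (L := L) ρ β = (trivialMeasure G d L).tilted fun U => -(β * wilsonAction ρ U) := by
  rw [wilsonMeasure_eq_tilted_neg ρ hρ β]
  congr 1
  funext U
  ring

/-- **The fibre-variance expectation of `S_e` under `μ_β` is at least `e^{-8NK²|β|}·Var_Haar(Re tr ρ)`**
(`K = (d+1)d²`; block comparison with `β = 0`, where it equals `#plaqThrough(e)·Var_Haar ≥ Var_Haar`).
[ours] -/
theorem integral_fibreVariance_wilsonMeasure_ge (hd : 2 ≤ d) (hL : 2 ≤ L) (hρ : Continuous ρ)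
    (hρu : ∀ g, ρ g ∈ Matrix.unitaryGroup (Fin N) ℂ) (β : ℝ) (e : Edge d L) :
    Real.exp (-(|β| * (2 * N * ((4 * ((d + 1) * d ^ 2) * ((d + 1) * d ^ 2) : ℕ) : ℝ)))) *
        variance (fun g => (ρ g).trace.re) (haarProbability G) ≤
      ∫ U, variance (fun h => linkAction ρ e (Pi.mulSingle e h * U)) (haarProbability G)
        ∂(wilsonMeasure (d := d) (L := L) ρ β) := by
  have hf : Continuous (linkAction (d := d) (L := L) ρ e) := continuous_linkAction ρ hρ e
  -- block comparison
  have hblock := integral_tilted_ge_block (G := G) (linkBlock e) β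
    (2 * N * ((4 * ((d + 1) * d ^ 2) * ((d + 1) * d ^ 2) : ℕ) : ℝ))
    (S := wilsonAction (d := d) (L := L) ρ)
    (Φ := fun U => variance (fun h => linkAction ρ e (Pi.mulSingle e h * U)) (haarProbability G))
    (continuous_wilsonAction_of_continuous ρ hρ) (continuous_fibreVariance e hf)
    (fun U => variance_nonneg _ _) (fun U V hUV => by
      have : (fun h => linkAction ρ e (Pi.mulSingle e h * U)) = fun h => linkAction ρ e (Pi.mulSingle e h * V) :=
        funext fun h => linkAction_congr_block ρ fun e' he' => by simp only [Pi.mul_apply, hUV e' he']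
      simp only [this])
    (fun k k' U => (wilsonAction_piecewise_sub_le' ρ hρ (linkBlock e) k k' U).trans (by
      have h := card_linkBlock_le (d := d) (L := L) e
      have h0 : (0 : ℝ) ≤ 2 * N := by positivity
      refine mul_le_mul_of_nonneg_left ?_ h0
      exact_mod_cast Nat.mul_le_mul_right _ h))
  rw [← wilsonMeasure_eq_tilted_neg_mul ρ hρ β] at hblock
  refine le_trans ?_ hblock
  rw [integral_fibreVariance_linkAction ρ hL hρ hρu e]
  refine mul_le_mul_of_nonneg_left ?_ (Real.exp_nonneg _)
  have hv : 0 ≤ variance (fun g => (ρ g).trace.re) (haarProbability G) := variance_nonneg _ _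
  have h1 : (1 : ℝ) ≤ (plaqThrough e).card := by exact_mod_cast one_le_card_plaqThrough hd e
  nlinarith

/-- **THE VARIANCE OF THE WILSON ACTION IS EXTENSIVE AT EVERY COUPLING, UNIFORMLY IN THE VOLUME.**
For `G` compact second countable, `ρ` continuous and unitary, `d ≥ 2`, every `L ≥ 2` and every real
`β`, with `K = (d+1)d²`:
`Var_{μ_β}(S_W^ρ) ≥ exp(−|β|·2N·K·(1+4K)) · ⌊L/2⌋^d · Var_Haar(Re tr ρ)`. [ours] -/
theorem wilson_variance_ge_allCouplings (hd : 2 ≤ d) (hL : 2 ≤ L) (hρ : Continuous ρ)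
    (hρu : ∀ g, ρ g ∈ Matrix.unitaryGroup (Fin N) ℂ) (β : ℝ) :
    Real.exp (-(|β| * (2 * N * ((d + 1) * d ^ 2 : ℕ) * (1 + 4 * ((d + 1) * d ^ 2 : ℕ))))) *
        ((L / 2) ^ d : ℕ) * variance (fun g => (ρ g).trace.re) (haarProbability G) ≤
      variance (wilsonAction (d := d) (L := L) ρ) (wilsonMeasure (d := d) (L := L) ρ β) := by
  have hd0 : 0 < d := by omega
  set i₀ : Fin d := ⟨0, hd0⟩ with hi₀
  set A : Finset (Edge d L) := evenLinks (L := L) i₀ with hA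
  set v : ℝ := variance (fun g => (ρ g).trace.re) (haarProbability G) with hv
  set B : ℝ := 2 * N * ((d + 1) * d ^ 2 : ℕ) with hB
  set B' : ℝ := 2 * N * ((4 * ((d + 1) * d ^ 2) * ((d + 1) * d ^ 2) : ℕ) : ℝ) with hB'
  have hS : Continuous (wilsonAction (d := d) (L := L) ρ) := continuous_wilsonAction_of_continuous ρ hρ
  -- stage 1: the summed fibre variances
  have h1 := variance_tilted_ge_sum_fibreVariance (G := G) β B hS (fun e => linkAction (d := d) (L := L) ρ e)
    (fun e => continuous_linkAction ρ hρ e) (fun e U V => linkAction_osc_le ρ hρ e U V) A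
    (fun e _ h U => wilsonAction_sub_linkAction_fibre ρ e h U)
    (fun e he e' he' hne h U => linkAction_fibre_of_ne ρ (evenLinks_pairwise i₀ he he' hne) h U)
  rw [← wilsonMeasure_eq_tilted_neg_mul ρ hρ β] at h1
  -- stage 2: each fibre-variance expectation is at least `e^{-|β|B'} v`
  have h2 : ∀ e ∈ A, Real.exp (-(|β| * B')) * v ≤
      ∫ U, variance (fun h => linkAction ρ e (Pi.mulSingle e h * U)) (haarProbability G)
        ∂(wilsonMeasure (d := d) (L := L) ρ β) := fun e _ =>
    integral_fibreVariance_wilsonMeasure_ge ρ hd hL hρ hρu β e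
  have hsum : (A.card : ℝ) * (Real.exp (-(|β| * B')) * v) ≤
      ∑ e ∈ A, ∫ U, variance (fun h => linkAction ρ e (Pi.mulSingle e h * U)) (haarProbability G)
        ∂(wilsonMeasure (d := d) (L := L) ρ β) := by
    rw [← nsmul_eq_mul, ← Finset.sum_const]
    exact Finset.sum_le_sum h2
  have hcard : (A.card : ℝ) = ((L / 2) ^ d : ℕ) := by rw [hA, card_evenLinks]
  -- assemble: `e^{-|β|(B+B')} ⌊L/2⌋^d v ≤ e^{-|β|B} Σ ≤ Var`
  have hexp : Real.exp (-(|β| * (2 * N * ((d + 1) * d ^ 2 : ℕ) * (1 + 4 * ((d + 1) * d ^ 2 : ℕ))))) =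
      Real.exp (-(|β| * B)) * Real.exp (-(|β| * B')) := by
    rw [← Real.exp_add, hB, hB']
    congr 1
    push_cast
    ring
  rw [hexp]
  calc Real.exp (-(|β| * B)) * Real.exp (-(|β| * B')) * ((L / 2) ^ d : ℕ) * v
      = Real.exp (-(|β| * B)) * ((A.card : ℝ) * (Real.exp (-(|β| * B')) * v)) := by rw [hcard]; ring
    _ ≤ Real.exp (-(|β| * B)) * ∑ e ∈ A, ∫ U, variance (fun h => linkAction ρ e (Pi.mulSingle e h * U))
          (haarProbability G) ∂(wilsonMeasure (d := d) (L := L) ρ β) :=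
        mul_le_mul_of_nonneg_left hsum (Real.exp_nonneg _)
    _ ≤ _ := h1

/-! ## §2 A Fisher zero within a volume-independent distance of every real coupling -/

/-- **FISHER ZEROS NEAR EVERY REAL COUPLING, UNIFORMLY IN THE VOLUME.**  If `Var_Haar(Re tr ρ) > 0`
(`ρ` continuous unitary, `G` compact second countable), `d ≥ 2`, then for every `L ≥ 2` and every real
`β` the partition function `Z_L(s) = ∫ D[U] e^{-sS_W}` has a zero `s₀` with
`|s₀ − β| ≤ 4N·d²·3^d·exp(|β|·2NK(1+4K)) / Var_Haar(Re tr ρ)` (`K = (d+1)d²`). [ours] -/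
theorem wilson_exists_fisherZero_near_allCouplings (hd : 2 ≤ d) (hL : 2 ≤ L) (hρ : Continuous ρ)
    (hρu : ∀ g, ρ g ∈ Matrix.unitaryGroup (Fin N) ℂ)
    (hv : 0 < variance (fun g => (ρ g).trace.re) (haarProbability G)) (β : ℝ) :
    ∃ s₀ : ℂ, ‖s₀ - β‖ ≤ 4 * N * ((d ^ 2 * 3 ^ d : ℕ) : ℝ) *
        Real.exp (|β| * (2 * N * ((d + 1) * d ^ 2 : ℕ) * (1 + 4 * ((d + 1) * d ^ 2 : ℕ)))) /
        variance (fun g => (ρ g).trace.re) (haarProbability G) ∧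
      complexMGF (fun U => -wilsonAction ρ U) (trivialMeasure G d L) s₀ = 0 := by
  set D := trivialMeasure G d L with hD
  set v : ℝ := variance (fun g => (ρ g).trace.re) (haarProbability G) with hvdef
  set c : ℝ := 2 * N * ((d + 1) * d ^ 2 : ℕ) * (1 + 4 * ((d + 1) * d ^ 2 : ℕ)) with hc
  set P : ℝ := (Fintype.card (Plaquette d L) : ℝ) with hP
  haveI : IsProbabilityMeasure D := trivialMeasure_isProbabilityMeasure
  have hfloor := wilson_variance_ge_allCouplings (d := d) (L := L) ρ hd hL hρ hρu β
  rw [← hvdef, ← hc] at hfloor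
  have hhalf : (1 : ℝ) ≤ ((L / 2) ^ d : ℕ) := by
    have : 1 ≤ (L / 2) ^ d := Nat.one_le_pow _ _ (by omega)
    exact_mod_cast this
  have hfloorpos : 0 < Real.exp (-(|β| * c)) * ((L / 2) ^ d : ℕ) * v := by positivity
  have hvarpos : 0 < variance (wilsonAction (d := d) (L := L) ρ) (wilsonMeasure (d := d) (L := L) ρ β) :=
    lt_of_lt_of_le hfloorpos hfloor
  -- the abstract tilted-measure radius law of `FisherZeroNearCouplingSharp`
  have hm : AEMeasurable (fun U => -wilsonAction ρ U) D :=
    (WilsonRP.measurable_wilsonAction ρ hρ).neg.aemeasurable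
  have hb : ∀ᵐ U ∂D, |(-wilsonAction ρ U) - (-((N : ℝ) * P))| ≤ (N : ℝ) * P :=
    ae_of_all _ fun U => by
      have h0 := WilsonPinching.wilsonAction_nonneg ρ hρ U
      have h1 := WilsonPinching.wilsonAction_le ρ hρ U
      rw [abs_le, hP]
      constructor <;> linarith
  have hVt : variance (fun U => -wilsonAction ρ U) (D.tilted fun U => β * (-wilsonAction ρ U)) =
      variance (wilsonAction (d := d) (L := L) ρ) (wilsonMeasure (d := d) (L := L) ρ β) := by
    rw [hD, ← wilsonMeasure_eq_tilted_neg ρ hρ β, variance_fun_neg]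
  have hvar' : 0 < variance (fun U => -wilsonAction ρ U) (D.tilted fun U => β * (-wilsonAction ρ U)) := by
    rw [hVt]; exact hvarpos
  obtain ⟨s₀, hs₀, hz⟩ := exists_zero_near_norm_le_of_variance_tilted_pos hm hb β hvar'
  refine ⟨s₀, hs₀.trans ?_, hz⟩
  rw [hVt, abs_of_nonneg (by positivity)]
  -- `4NP / Var ≤ 4NP / floor ≤ 4N d² 3^d e^{c|β|} / v`
  have hPle : P ≤ ((d ^ 2 * 3 ^ d : ℕ) : ℝ) * ((L / 2) ^ d : ℕ) := by
    rw [hP]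
    have h1 := LatticeForm.card_plaquette_le (d := d) (L := L)
    have h2 := pow_le_three_pow_mul_half_pow (d := d) hL
    have : Fintype.card (Plaquette d L) ≤ d ^ 2 * 3 ^ d * (L / 2) ^ d :=
      h1.trans (by rw [mul_assoc]; exact Nat.mul_le_mul_left _ h2)
    exact_mod_cast this
  calc 4 * ((N : ℝ) * P) / variance (wilsonAction (d := d) (L := L) ρ) (wilsonMeasure (d := d) (L := L) ρ β)
      ≤ 4 * ((N : ℝ) * P) / (Real.exp (-(|β| * c)) * ((L / 2) ^ d : ℕ) * v) :=
        div_le_div_of_nonneg_left (by positivity) hfloorpos hfloor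
    _ ≤ 4 * ((N : ℝ) * (((d ^ 2 * 3 ^ d : ℕ) : ℝ) * ((L / 2) ^ d : ℕ))) /
          (Real.exp (-(|β| * c)) * ((L / 2) ^ d : ℕ) * v) := by
        gcongr
    _ = 4 * N * ((d ^ 2 * 3 ^ d : ℕ) : ℝ) * Real.exp (|β| * c) / v := by
        rw [Real.exp_neg]
        have hE : Real.exp (|β| * c) ≠ 0 := (Real.exp_pos _).ne'
        have hLd : (((L / 2) ^ d : ℕ) : ℝ) ≠ 0 := by positivity
        field_simp

/-! ## §3 The reweighting / annealing law at every coupling -/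

/-- **ONE EXACT REWEIGHTING STEP AT ANY COUPLING COSTS `exp(δ² · e^{-c·max(|β|,|β+2δ|)} · ⌊L/2⌋^d · v_ρ)`
IN WEIGHT SECOND MOMENT** (`δ ≥ 0`, every `L ≥ 2`, `d ≥ 2`): with `w = dμ_{β+δ}/dμ_β`,
`E_{μ_β}[w²] ≥ exp(δ² · e^{-c·M} · ⌊L/2⌋^d · Var_Haar(Re tr ρ))`, `M = max |β| |β+2δ|`, `c = 2NK(1+4K)`.
Hence at fixed per-step weight variance the number of steps is linear in the volume, at every coupling.
[ours] -/
theorem wilson_weight_sq_ge_exp_allCouplings (hd : 2 ≤ d) (hL : 2 ≤ L) (hρ : Continuous ρ)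
    (hρu : ∀ g, ρ g ∈ Matrix.unitaryGroup (Fin N) ℂ) {β δ : ℝ} (hδ : 0 ≤ δ) :
    Real.exp (δ ^ 2 * (Real.exp (-(max |β| |β + 2 * δ| *
        (2 * N * ((d + 1) * d ^ 2 : ℕ) * (1 + 4 * ((d + 1) * d ^ 2 : ℕ))))) *
        ((L / 2) ^ d : ℕ) * variance (fun g => (ρ g).trace.re) (haarProbability G))) ≤
      ∫ U, (Real.exp (-(δ * wilsonAction ρ U)) *
        (mgf (fun U => -wilsonAction ρ U) (trivialMeasure G d L) β /
          mgf (fun U => -wilsonAction ρ U) (trivialMeasure G d L) (β + δ))) ^ 2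
      ∂(wilsonMeasure (d := d) (L := L) ρ β) := by
  set c : ℝ := 2 * N * ((d + 1) * d ^ 2 : ℕ) * (1 + 4 * ((d + 1) * d ^ 2 : ℕ)) with hc
  refine weight_sq_integral_ge_exp_anyGroup (d := d) (L := L) hρ hδ fun u hu => ?_
  have hfloor := wilson_variance_ge_allCouplings (d := d) (L := L) ρ hd hL hρ hρu u
  rw [← hc] at hfloor
  refine le_trans ?_ hfloor
  have hv : 0 ≤ variance (fun g => (ρ g).trace.re) (haarProbability G) := variance_nonneg _ _
  have hc0 : 0 ≤ c := by rw [hc]; positivity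
  have hu' : |u| ≤ max |β| |β + 2 * δ| := by
    rw [abs_le]
    constructor
    · have := neg_abs_le β
      have := le_max_left |β| |β + 2 * δ|
      linarith [hu.1]
    · have := le_abs_self (β + 2 * δ)
      have := le_max_right |β| |β + 2 * δ|
      linarith [hu.2]
  have hexp : Real.exp (-(max |β| |β + 2 * δ| * c)) ≤ Real.exp (-(|u| * c)) :=
    Real.exp_le_exp.2 (by nlinarith)
  have hLd : (0 : ℝ) ≤ ((L / 2) ^ d : ℕ) := by positivity
  exact mul_le_mul_of_nonneg_right (mul_le_mul_of_nonneg_right hexp hLd) hv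

/-- **THE ANNEALING COST LAW AT EVERY COUPLING**: for a `k`-step schedule `β_{i+1} = β_i + δ_i`
(`0 ≤ δ_i ≤ D`, `k ≥ 1`) with `[β_0, β_k + D] ⊆ [−M, M]`, the summed log weight second moments satisfy
`∑_i (ψ(β_i+2δ_i) − 2ψ(β_i+δ_i) + ψ(β_i)) ≥ e^{-cM} · ⌊L/2⌋^d · Var_Haar(Re tr ρ) · (β_k − β_0)²/k`
(`ψ = cgf(−S_W)`, `c = 2NK(1+4K)`): at fixed total cost the number of steps is at least a constant times
the VOLUME times `(Δβ)²`, at every coupling (GEN-8 had this inside the strong-coupling window only).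
[ours] -/
theorem wilson_schedule_cost_ge_allCouplings (hd : 2 ≤ d) (hL : 2 ≤ L) (hρ : Continuous ρ)
    (hρu : ∀ g, ρ g ∈ Matrix.unitaryGroup (Fin N) ℂ) {k : ℕ} (hk : 1 ≤ k)
    (β δ : ℕ → ℝ) (hstep : ∀ i, β (i + 1) = β i + δ i) (hδ : ∀ i < k, 0 ≤ δ i) {D M : ℝ}
    (hD : ∀ i < k, δ i ≤ D) (hlo : -M ≤ β 0) (hhi : β k + D ≤ M) :
    Real.exp (-(M * (2 * N * ((d + 1) * d ^ 2 : ℕ) * (1 + 4 * ((d + 1) * d ^ 2 : ℕ))))) *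
        ((L / 2) ^ d : ℕ) * variance (fun g => (ρ g).trace.re) (haarProbability G) *
        (β k - β 0) ^ 2 / k ≤
      ∑ i ∈ Finset.range k,
        (cgf (fun U => -wilsonAction ρ U) (trivialMeasure G d L) (β i + 2 * δ i) -
          2 * cgf (fun U => -wilsonAction ρ U) (trivialMeasure G d L) (β i + δ i) +
          cgf (fun U => -wilsonAction ρ U) (trivialMeasure G d L) (β i)) := by
  set c : ℝ := 2 * N * ((d + 1) * d ^ 2 : ℕ) * (1 + 4 * ((d + 1) * d ^ 2 : ℕ)) with hc
  set m : ℝ := Real.exp (-(M * c)) * ((L / 2) ^ d : ℕ) * variance (fun g => (ρ g).trace.re)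
    (haarProbability G) with hm
  have hc0 : 0 ≤ c := by rw [hc]; positivity
  have hm0 : 0 ≤ m := by
    have : 0 ≤ variance (fun g => (ρ g).trace.re) (haarProbability G) := variance_nonneg _ _
    rw [hm]; positivity
  -- monotone couplings
  have hsum : ∀ j, β j = β 0 + ∑ i ∈ Finset.range j, δ i := by
    intro j
    induction j with
    | zero => simp
    | succ j ih => rw [hstep, ih, Finset.sum_range_succ]; ring
  have hmono : ∀ j ≤ k, ∀ i ≤ j, β i ≤ β j := by
    intro j hj i hij
    rw [hsum i, hsum j, add_le_add_iff_left]
    exact Finset.sum_le_sum_of_subset_of_nonneg (Finset.range_subset_range.2 hij)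
      fun l hl _ => hδ l (lt_of_lt_of_le (Finset.mem_range.1 hl) hj)
  -- the uniform floor `m` on `[−M, M] ⊇ [β_i, β_i + 2δ_i]`
  have hfloor : ∀ i < k, ∀ u ∈ Icc (β i) (β i + 2 * δ i),
      m ≤ variance (wilsonAction (d := d) (L := L) ρ) (wilsonMeasure (d := d) (L := L) ρ u) := by
    intro i hi u hu
    have h := wilson_variance_ge_allCouplings (d := d) (L := L) ρ hd hL hρ hρu u
    rw [← hc] at h
    refine le_trans ?_ h
    have h1 : β 0 ≤ β i := hmono i hi.le 0 (Nat.zero_le i)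
    have h2 : β (i + 1) ≤ β k := hmono k le_rfl (i + 1) hi
    have h3 : β i + δ i = β (i + 1) := (hstep i).symm
    have hu' : |u| ≤ M := by
      rw [abs_le]; constructor <;> linarith [hu.1, hu.2, hD i hi]
    have hv : 0 ≤ variance (fun g => (ρ g).trace.re) (haarProbability G) := variance_nonneg _ _
    have hexp : Real.exp (-(M * c)) ≤ Real.exp (-(|u| * c)) := Real.exp_le_exp.2 (by nlinarith)
    have hLd : (0 : ℝ) ≤ ((L / 2) ^ d : ℕ) := by positivity
    exact mul_le_mul_of_nonneg_right (mul_le_mul_of_nonneg_right hexp hLd) hv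
  have h := schedule_sum_ge_of_floors (d := d) (L := L) ρ hρ k β δ (fun _ => m) hδ hfloor
  -- Cauchy–Schwarz: `m (β_k − β_0)²/k ≤ Σ δ_i² m`
  have hk0 : (0 : ℝ) < k := by exact_mod_cast hk
  have hcs := Finset.sum_mul_sq_le_sq_mul_sq (Finset.range k) (fun _ => (1 : ℝ)) (fun i => δ i)
  simp only [one_mul, one_pow, Finset.sum_const, Finset.card_range, nsmul_eq_mul, mul_one] at hcs
  have hΔ : β k - β 0 = ∑ i ∈ Finset.range k, δ i := by rw [hsum k]; ring
  have hbound : m * (β k - β 0) ^ 2 / k ≤ ∑ i ∈ Finset.range k, δ i ^ 2 * m := by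
    rw [hΔ, div_le_iff₀ hk0, ← Finset.sum_mul]
    nlinarith [hcs, hm0]
  exact hbound.trans h

end Summit.Ventures.LatticeQCDFlow.TrivializingMaps
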